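import Literature.IUT.HodgeArakelov.BadPlaceSettingAtModelTateYRow
import Literature.IUT.HodgeArakelov.GaloisPairCyclotomesCor111AtModelTate
import Literature.IUT.HodgeArakelov.ThetaSettingCompletionPackage
import Literature.AnabelianGeometry.SemiGraphs.TemperedCurveDataNonVacuity
import HarnessLib

/-!
# (H1) «`Δ ⊆ Π^tp_{X̲̲}` characteristic» VIA `Π^tp_{Y̲̲}`: at every [EtTh] §1 theta setting,
# `Δ^tp_{X̲̲} = {g | ⁅g, Π^tp_{Y̲̲}⁆ ⊆ Δ^tp_{Y̲̲}}`; hence, wherever `Π^tp_{Y̲̲}` is characteristic (the stage-2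
# models, NO binder), (H1) `hΔX` ⟺ «`Δ^tp_{Y̲̲} = Δ ∩ Π^tp_{Y̲̲}` characteristic» (MChar) — proof-only; D-0079 K-L6

S. Mochizuki, *Inter-universal Teichmüller theory II*, §1, Example 1.8 (i), kurims manuscript (Dec. 2020) p. 35: "the
subgroup `Δ ⊆ Π` [...] may be characterized group-theoretically" [claim: Mochizuki2012, status: disputed] (IUTchII §1
Ex 1.8 (i), kurims p.35); S. Mochizuki, *The étale theta function …*, Publ. RIMS **45** (2009) [EtTh], §1 p. 12
("`Π^tp_Y`", "`Z`"), Prop. 2.2 (iii) p. 37 ("`G_K ≅ Π_{X̲̲}/Δ_{X̲̲}`"), Prop. 2.4 p. 38 (PRIMS PDF pages)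
[cite: MochizukiEtTh2009, Prop 2.4 p.38]; S. Mochizuki, *Semi-graphs of anabelioids*, Publ. RIMS **42** (2006)
[SemiAnbd], §6 p. 69 (`1 → Δ^temp → Π^temp → G_K → 1`); S. Mochizuki, *The local pro-p anabelian geometry of curves*,
Invent. Math. **138** (1999), Lemma 15.8 p. 80 (`G_{ℚ_p}` slim — PROVED in the tree: `isSlimGroup_GQp`).
Cell `abc-iut`, layer L6, seat abc-iut-w4-d043 (gen 8; lineage of record of the [IUTchII] Cor. 1.12 model chain,
`ThetaEvaluationCor112AtModelTate` p459069 / `…Inversion` p461458, whose custody list carries the (H1) binder `hΔX`),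
row «HDELTAX-MODELTATE-REDUCTION» (abc-iut-L2-lead R565 18:45:16Z = abc-iut-L6-lead §F v1.19bg (5)
«MCHAR-REDUCTION-AT-MODELTATE»), after abc-iut-f-142's desk reduction (STATUS 2026-08-26T18:11:29Z, cited BY NAME; clause (a)
there — `Π^tp_{Y̲̲}` characteristic at the Tate model — is abc-iut-w5-d233's LANDED theorem
`ModelTateCarriers.isTopCharacteristic_GtpY_subgroupOf_Huu_modelχq` over abc-iut-w5-d091's `isCompact_GtpY_modelχq`, consumed
BY NAME).  PROOF-ONLY: no definition, no instance, no `Prop`-valued fact; nothing of another seat restated.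

NOTATION.  `D` an [EtTh] §1 theta setting, `C : E.DoubleUnderline l` a choice of `X̲̲` (`Π := Π^tp_{X̲̲} = C.Huu`),
`Δ := Δ^tp_{X̲̲} = Ker(Π ↠ G_K) = Δ^tp_X ∩ Π` (the (H1) subgroup: at the [IUTchII] §1 setting `ThetaSetting.ofDoubleUnderline`
it IS `DeltaX`, `deltaX_ofDoubleUnderline_eq`), `K := Π^tp_{Y̲̲} = Π^tp_Y ∩ Π = Ker(Π ↠ Gal(Y̲̲/X̲̲) ≅ ℤ)`, `M := Δ ∩ K =
Δ^tp_{Y̲̲}`.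

* §1 `DoubleUnderline.coe_mem_deltaTemp_iff_forall_commutator` — **`Δ = {g ∈ Π | ∀ k ∈ K, ⁅g, k⁆ ∈ M}`** at EVERY theta
  setting: `⊆` because `Δ` is normal and `Π/K ≅ ℤ` is abelian; `⊇` because `K ↠ G_K` (`map_aug_Ydduu`, "`Ÿ̲̲` geometrically
  connected over `K`") and `G_K`, an open subgroup of the SLIM group `G_{ℚ_p}`, has trivial centraliser — pure group theory
  over landed facts, NO binder.
* §1 `DoubleUnderline.map_deltaTemp_subgroupOf_eq_of_map_GtpY_of_map_inf` — for ANY group automorphism `φ` of `Π`: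
  `φ(K) = K ∧ φ(M) = M ⇒ φ(Δ) = Δ`; and conversely `φ(K) = K ∧ φ(Δ) = Δ ⇒ φ(M) = M`.  Hence
  `DoubleUnderline.isTopCharacteristic_deltaTemp_subgroupOf_iff`: **if `K` is characteristic in the topological group `Π`, then
  «`Δ` characteristic» ⟺ «`M` characteristic»**.
* §2 the same in the [IUTchII] currency of the (H1) binder: `ThetaSetting.deltaX_characteristic_ofDoubleUnderline_iff_of_piY`.
* §3 AT THE STAGE-2 MODELS `ThetaSetting.modelχq p i j hj` (every `E`, every `X̲̲`): `K` IS characteristic (w5-d233), so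
  **(H1) ⟺ MChar with NO binder** (`deltaX_characteristic_ofDoubleUnderline_modelχq_iff_mChar`); §4 at the Tate model's carrier
  of record, in the LITERAL `EtaleLevels.setting` currency of the `hΔX` binder of p456925 / p459069 / p461458:
  `ModelTateCarriers.hΔX_setting_modelTate_iff_mChar` and the consumable direction `…_of_mChar`.

WHAT THIS DOES AND DOES NOT DO.  MChar («`Δ^tp_{Y̲̲} = Δ ∩ Π^tp_{Y̲̲}` is carried onto itself by every topological automorphism
of `Π^tp_{X̲̲}`») is NOT decided here in either direction: at the Tate model `Π^tp_{X̲̲} = dUU l ⋊ G_{ℚ_p}` it is a rigidity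
statement for (free-profinite-by-`ℤ`) ⋊ `G_{ℚ_p}` recorded by abc-iut-L2-lead as the NAMED UNDECIDED RESIDUAL OF RECORD
(FOUNDATIONS census item 6).  The file SHARPENS the custody binder `hΔX` to MChar (the `Δ`-versus-`G_K` question is reduced
to the compact part `K`, where `Δ`'s infinite cyclic quotient no longer interferes) and records the intrinsic commutator
description of `Δ`.  HONEST LABEL: `modelχq` / `modelTate` are SEMI-SYNTHETIC models of the typed [EtTh] §1 interface (not the
tempered `π₁` of a curve); nothing of [IUTchII] (claim key `Mochizuki2012`, DISPUTED, D-0012) or of [EtTh] is asserted beyond the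
tree's proofs; no side is taken on [IUTchIII] Cor. 3.12; typed ≠ proved; a reduction is not a verdict; nothing here says abc
is proved or refuted.
-/

noncomputable section

open scoped commutatorElement

/-! ## §1. Pure group theory at an [EtTh] §1 theta setting: `Δ` through commutators with `Π^tp_{Y̲̲}` -/

namespace Literature.AnabelianGeometry.EtaleTheta.ThetaSetting.EtaleThetaData.DoubleUnderline

open Literature.AnabelianGeometry.SemiGraphs

variable {p : ℕ} [Fact p.Prime] {D : Literature.AnabelianGeometry.EtaleTheta.ThetaSetting p}
  {E : D.EtaleThetaData} {l : ℕ} (C : E.DoubleUnderline l)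

/-- `Π^tp_{Y̲̲} = Π^tp_Y ∩ Π^tp_{X̲̲}` maps ONTO `G_K` under the augmentation ("`Ÿ̲̲`", hence `Y̲̲`, "geometrically connected over
`K`": `map_aug_Ydduu` and `Π^tp_Ÿ ⊆ Π^tp_Y`). [cite: MochizukiEtTh2009, Prop 2.2 (iii) p.37] -/
theorem map_aug_GtpY_inf_Huu : (D.GtpY ⊓ C.Huu).map D.aug.toMonoidHom = D.GK := by
  refine le_antisymm ?_ ?_
  · rintro _ ⟨x, -, rfl⟩
    exact D.aug_mem_GK x
  · rw [← C.map_aug_Ydduu]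
    exact Subgroup.map_mono (inf_le_inf_right _ D.GtpYdd_le_GtpY)

/-- `G_K` has trivial centraliser in `G_{ℚ_p}`: it is open (`K/ℚ_p` finite) in the SLIM group `G_{ℚ_p}` ([pGC] Lemma 15.8,
the tree's `isSlimGroup_GQp`).  In particular an element of `G_K` commuting with all of `G_K` is trivial.
[cite: MochizukiLocAn1999, Lem 15.8 p.80] -/
theorem _root_.Literature.AnabelianGeometry.EtaleTheta.ThetaSetting.eq_one_of_forall_mem_GK_commute
    (D : Literature.AnabelianGeometry.EtaleTheta.ThetaSetting p) {σ : GQp p} (h : ∀ τ ∈ D.GK, τ * σ = σ * τ) :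
    σ = 1 := by
  have hopen : IsOpen (D.GK : Set (GQp p)) := by rw [← D.GKN_one]; exact D.isOpen_GKN 1
  have hc : Subgroup.centralizer (D.GK : Set (GQp p)) = ⊥ :=
    (TemperedCurve.isSlimGroup_GQp (p := p)).centralizer_eq_bot D.GK hopen
  have hσ : σ ∈ Subgroup.centralizer (D.GK : Set (GQp p)) := Subgroup.mem_centralizer_iff.2 h
  rw [hc] at hσ
  exact Subgroup.mem_bot.1 hσ

/-- For `g ∈ Δ^tp_{X̲̲}` and ANY `k ∈ Π^tp_{X̲̲}`, the commutator `⁅g, k⁆` lies in `Δ^tp_{Y̲̲} = Δ ∩ Π^tp_{Y̲̲}`: in `Δ` since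
`Δ = Ker(aug)` is normal, in `Π^tp_{Y̲̲} = Ker(Π^tp_{X̲̲} ↠ Z)` since `Z ≅ ℤ` is abelian. [cite: MochizukiEtTh2009, §1 p.12] -/
theorem commutator_mem_of_coe_mem_deltaTemp {g : C.Huu} (hg : (g : D.PiTemp) ∈ D.DeltaTemp) (k : C.Huu) :
    ⁅g, k⁆ ∈ D.DeltaTemp.subgroupOf C.Huu ⊓ D.GtpY.subgroupOf C.Huu := by
  refine Subgroup.mem_inf.2 ⟨Subgroup.mem_subgroupOf.2 ?_, Subgroup.mem_subgroupOf.2 ?_⟩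
  · change D.aug.toMonoidHom (((⁅g, k⁆ : C.Huu) : D.PiTemp)) = 1
    have hg' : D.aug.toMonoidHom (g : D.PiTemp) = 1 := hg
    change D.aug.toMonoidHom ⁅(g : D.PiTemp), (k : D.PiTemp)⁆ = 1
    rw [map_commutatorElement, hg', commutatorElement_def, one_mul, inv_one, mul_one, mul_inv_cancel]
  · change D.toZ (((⁅g, k⁆ : C.Huu) : D.PiTemp)) = 1
    change D.toZ ⁅(g : D.PiTemp), (k : D.PiTemp)⁆ = 1
    rw [map_commutatorElement, commutatorElement_eq_one_iff_commute]
    exact Commute.all _ _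

/-- **`Δ^tp_{X̲̲} = {g ∈ Π^tp_{X̲̲} | ∀ k ∈ Π^tp_{Y̲̲}, ⁅g, k⁆ ∈ Δ^tp_{Y̲̲}}`** at EVERY [EtTh] §1 theta setting (pure group
theory: `⊆` by normality of `Δ` and commutativity of `Z`; `⊇` because `Π^tp_{Y̲̲} ↠ G_K` and `G_K ≤ G_{ℚ_p}` has trivial
centraliser, `G_{ℚ_p}` being slim). [cite: MochizukiEtTh2009, Prop 2.2 (iii) p.37] -/
theorem coe_mem_deltaTemp_iff_forall_commutator (g : C.Huu) :
    (g : D.PiTemp) ∈ D.DeltaTemp ↔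
      ∀ k : C.Huu, k ∈ D.GtpY.subgroupOf C.Huu →
        ⁅g, k⁆ ∈ D.DeltaTemp.subgroupOf C.Huu ⊓ D.GtpY.subgroupOf C.Huu := by
  constructor
  · intro hg k _
    exact C.commutator_mem_of_coe_mem_deltaTemp hg k
  · intro h
    change D.aug.toMonoidHom (g : D.PiTemp) = 1
    refine D.eq_one_of_forall_mem_GK_commute fun τ hτ => ?_
    have hτ' : τ ∈ (D.GtpY ⊓ C.Huu).map D.aug.toMonoidHom := by rw [C.map_aug_GtpY_inf_Huu]; exact hτ
    obtain ⟨k, hk, rfl⟩ := hτ'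
    obtain ⟨hkY, hkH⟩ := Subgroup.mem_inf.1 hk
    have hcomm := (Subgroup.mem_inf.1 (h ⟨k, hkH⟩ (Subgroup.mem_subgroupOf.2 hkY))).1
    rw [Subgroup.mem_subgroupOf] at hcomm
    change D.aug.toMonoidHom (((⁅g, (⟨k, hkH⟩ : C.Huu)⁆ : C.Huu) : D.PiTemp)) = 1 at hcomm
    change D.aug.toMonoidHom ⁅(g : D.PiTemp), k⁆ = 1 at hcomm
    rw [map_commutatorElement, commutatorElement_eq_one_iff_commute] at hcomm
    exact hcomm.eq.symm

/-- **Transport**: a group automorphism `φ` of `Π^tp_{X̲̲}` with `φ(Π^tp_{Y̲̲}) = Π^tp_{Y̲̲}` and `φ(Δ^tp_{Y̲̲}) = Δ^tp_{Y̲̲}`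
(`Δ^tp_{Y̲̲} = Δ ∩ Π^tp_{Y̲̲}`) satisfies `φ(Δ^tp_{X̲̲}) = Δ^tp_{X̲̲}` — by the commutator description of `Δ`.
[cite: MochizukiEtTh2009, Prop 2.4 p.38] -/
theorem map_deltaTemp_subgroupOf_eq_of_map_GtpY_of_map_inf (φ : C.Huu ≃* C.Huu)
    (hK : (D.GtpY.subgroupOf C.Huu).map φ.toMonoidHom = D.GtpY.subgroupOf C.Huu)
    (hM : (D.DeltaTemp.subgroupOf C.Huu ⊓ D.GtpY.subgroupOf C.Huu).map φ.toMonoidHom =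
      D.DeltaTemp.subgroupOf C.Huu ⊓ D.GtpY.subgroupOf C.Huu) :
    (D.DeltaTemp.subgroupOf C.Huu).map φ.toMonoidHom = D.DeltaTemp.subgroupOf C.Huu := by
  -- one inclusion for every automorphism `ψ` carrying `K` and `M` INTO themselves
  have key : ∀ ψ : C.Huu ≃* C.Huu,
      (∀ k, k ∈ D.GtpY.subgroupOf C.Huu → ψ.symm k ∈ D.GtpY.subgroupOf C.Huu) →
      (∀ m, m ∈ D.DeltaTemp.subgroupOf C.Huu ⊓ D.GtpY.subgroupOf C.Huu →
        ψ m ∈ D.DeltaTemp.subgroupOf C.Huu ⊓ D.GtpY.subgroupOf C.Huu) →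
      ∀ g, g ∈ D.DeltaTemp.subgroupOf C.Huu → ψ g ∈ D.DeltaTemp.subgroupOf C.Huu := by
    intro ψ hKψ hMψ g hg
    rw [Subgroup.mem_subgroupOf] at hg ⊢
    rw [C.coe_mem_deltaTemp_iff_forall_commutator] at hg ⊢
    intro k hk
    have h1 := hMψ _ (hg (ψ.symm k) (hKψ k hk))
    rwa [map_commutatorElement, MulEquiv.apply_symm_apply] at h1
  refine le_antisymm ?_ ?_
  · rintro _ ⟨g, hg, rfl⟩
    refine key φ (fun k hk => ?_) (fun m hm => ?_) g hg
    · have : k ∈ (D.GtpY.subgroupOf C.Huu).map φ.toMonoidHom := by rw [hK]; exact hk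
      exact Subgroup.mem_map_equiv.1 this
    · have : φ m ∈ (D.DeltaTemp.subgroupOf C.Huu ⊓ D.GtpY.subgroupOf C.Huu).map φ.toMonoidHom := ⟨m, hm, rfl⟩
      rwa [hM] at this
  · intro g hg
    refine Subgroup.mem_map_equiv.2 (key φ.symm (fun k hk => ?_) (fun m hm => ?_) g hg)
    · rw [MulEquiv.symm_symm]
      have : φ k ∈ (D.GtpY.subgroupOf C.Huu).map φ.toMonoidHom := ⟨k, hk, rfl⟩
      rwa [hK] at this
    · have : m ∈ (D.DeltaTemp.subgroupOf C.Huu ⊓ D.GtpY.subgroupOf C.Huu).map φ.toMonoidHom := by rw [hM]; exact hm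
      exact Subgroup.mem_map_equiv.1 this

/-- Conversely (trivially): `φ(Π^tp_{Y̲̲}) = Π^tp_{Y̲̲}` and `φ(Δ^tp_{X̲̲}) = Δ^tp_{X̲̲}` give `φ(Δ ∩ Π^tp_{Y̲̲}) = Δ ∩ Π^tp_{Y̲̲}`
(`φ` injective). [cite: MochizukiEtTh2009, Prop 2.4 p.38] -/
theorem map_inf_eq_of_map_GtpY_of_map_deltaTemp (φ : C.Huu ≃* C.Huu)
    (hK : (D.GtpY.subgroupOf C.Huu).map φ.toMonoidHom = D.GtpY.subgroupOf C.Huu)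
    (hΔ : (D.DeltaTemp.subgroupOf C.Huu).map φ.toMonoidHom = D.DeltaTemp.subgroupOf C.Huu) :
    (D.DeltaTemp.subgroupOf C.Huu ⊓ D.GtpY.subgroupOf C.Huu).map φ.toMonoidHom =
      D.DeltaTemp.subgroupOf C.Huu ⊓ D.GtpY.subgroupOf C.Huu := by
  rw [Subgroup.map_inf _ _ φ.toMonoidHom (show Function.Injective φ.toMonoidHom from φ.injective), hK, hΔ]

/-- **If `Π^tp_{Y̲̲}` is characteristic in the topological group `Π^tp_{X̲̲}`, then «`Δ^tp_{X̲̲}` characteristic» ⟺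
«`Δ^tp_{Y̲̲} = Δ ∩ Π^tp_{Y̲̲}` characteristic»** (the tree's `IsTopCharacteristic`, [EtTh] Def. 3.3).
[cite: MochizukiEtTh2009, Prop 2.4 p.38] -/
theorem isTopCharacteristic_deltaTemp_subgroupOf_iff (hK : IsTopCharacteristic C.Huu (D.GtpY.subgroupOf C.Huu)) :
    IsTopCharacteristic C.Huu (D.DeltaTemp.subgroupOf C.Huu) ↔
      IsTopCharacteristic C.Huu (D.DeltaTemp.subgroupOf C.Huu ⊓ D.GtpY.subgroupOf C.Huu) :=
  ⟨fun hΔ φ => C.map_inf_eq_of_map_GtpY_of_map_deltaTemp φ.toMulEquiv (hK φ) (hΔ φ),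
    fun hM φ => C.map_deltaTemp_subgroupOf_eq_of_map_GtpY_of_map_inf φ.toMulEquiv (hK φ) (hM φ)⟩

end Literature.AnabelianGeometry.EtaleTheta.ThetaSetting.EtaleThetaData.DoubleUnderline

/-! ## §2. In the [IUTchII] §1 currency: the (H1) binder of `ThetaSetting.ofDoubleUnderline` -/

namespace Literature.IUT.HodgeArakelov

open Literature.AnabelianGeometry.EtaleTheta Literature.AnabelianGeometry.SemiGraphs
open Literature.AnabelianGeometry.EtaleTheta.SettingModel
open scoped Literature.AnabelianGeometry.EtaleTheta

namespace ThetaSetting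

variable {p : ℕ} [Fact p.Prime] {D : Literature.AnabelianGeometry.EtaleTheta.ThetaSetting p}
  {E : D.EtaleThetaData} {l : ℕ} (C : E.DoubleUnderline l) {N : ℕ+} (μ : D.CyclotomeMod l N)
  (hC : D.Compat) (hS : D.Sec2Hyps) (hl : l.Prime) (hp2 : p ≠ 2) (hpl : p ≠ l)
  (hζ : ∃ ζ : D.K, IsPrimitiveRoot ζ (4 * l)) {η : (C.thetaEnvData μ hC hS).PiYdd → MuN p N}
  (hη : η ∈ (C.thetaEnvData μ hC hS).thetaCocycles)

/-- The (H1) subgroup `Δ := Ker(Π^tp_{X̲̲_k} ↠ G_k)` of the [IUTchII] §1 setting `ofDoubleUnderline` IS `Δ^tp_X ∩ Π^tp_{X̲̲}`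
(as subgroups of the one type `Π^tp_{X̲̲} = C.Huu`; abc-iut-w5-d233's `mem_deltaX_ofDoubleUnderline_iff`, as an equality).
[claim: Mochizuki2012, status: disputed] (IUTchII §1 Ex 1.8 (i), kurims p.35) -/
theorem deltaX_ofDoubleUnderline_eq :
    (ofDoubleUnderline C μ hC hS hl hp2 hpl hζ hη).DeltaX =
      (show Subgroup (ofDoubleUnderline C μ hC hS hl hp2 hpl hζ hη).PiX from D.DeltaTemp.subgroupOf C.Huu) := by
  ext h
  rw [mem_deltaX_ofDoubleUnderline_iff]
  exact (Subgroup.mem_subgroupOf (H := D.DeltaTemp) (K := C.Huu) (h := show C.Huu from h)).symm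

/-- **(H1) ⟺ MChar given the `Y̲̲`-clause, in the [IUTchII] currency.**  For the [IUTchII] §1 setting `S := ofDoubleUnderline …`
of the Tate curve (`Π^tp_{X̲̲_k} := C.Huu`): if `Π^tp_{Y̲̲}` is characteristic in the topological group `Π^tp_{X̲̲}`, then the
(H1) binder «every `φ : S.PiX ≃ₜ* S.PiX` carries `S.DeltaX` onto itself» holds IFF every such `φ` carries
`S.DeltaX ∩ Π^tp_{Y̲̲}` onto itself. [claim: Mochizuki2012, status: disputed] (IUTchII §1 Ex 1.8 (i), kurims p.35) -/
theorem deltaX_characteristic_ofDoubleUnderline_iff_of_piY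
    (hK : IsTopCharacteristic C.Huu (D.GtpY.subgroupOf C.Huu)) :
    (∀ φ : (ofDoubleUnderline C μ hC hS hl hp2 hpl hζ hη).PiX ≃ₜ* (ofDoubleUnderline C μ hC hS hl hp2 hpl hζ hη).PiX,
        (ofDoubleUnderline C μ hC hS hl hp2 hpl hζ hη).DeltaX.map φ.toMulEquiv.toMonoidHom =
          (ofDoubleUnderline C μ hC hS hl hp2 hpl hζ hη).DeltaX) ↔
      ∀ φ : (ofDoubleUnderline C μ hC hS hl hp2 hpl hζ hη).PiX ≃ₜ* (ofDoubleUnderline C μ hC hS hl hp2 hpl hζ hη).PiX,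
        ((ofDoubleUnderline C μ hC hS hl hp2 hpl hζ hη).DeltaX ⊓
            (show Subgroup (ofDoubleUnderline C μ hC hS hl hp2 hpl hζ hη).PiX from D.GtpY.subgroupOf C.Huu)).map
            φ.toMulEquiv.toMonoidHom =
          (ofDoubleUnderline C μ hC hS hl hp2 hpl hζ hη).DeltaX ⊓
            (show Subgroup (ofDoubleUnderline C μ hC hS hl hp2 hpl hζ hη).PiX from D.GtpY.subgroupOf C.Huu) := by
  rw [deltaX_ofDoubleUnderline_eq]
  exact C.isTopCharacteristic_deltaTemp_subgroupOf_iff hK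

end ThetaSetting

/-! ## §3. At the stage-2 models `ThetaSetting.modelχq p i j hj`: NO binder -/

namespace ModelTateCarriers

section StageTwo

variable (p : ℕ) [Fact p.Prime] (i j : ℤ) (hj : Even j)
  {E : (ThetaSetting.modelχq p i j hj).EtaleThetaData} {l : ℕ} (C : E.DoubleUnderline l) {N : ℕ+}
  (μ : (ThetaSetting.modelχq p i j hj).CyclotomeMod l N)
  (hC : (ThetaSetting.modelχq p i j hj).Compat) (hS : (ThetaSetting.modelχq p i j hj).Sec2Hyps)
  (hl : l.Prime) (hp2 : p ≠ 2) (hpl : p ≠ l) (hζ : ∃ ζ : (ThetaSetting.modelχq p i j hj).K, IsPrimitiveRoot ζ (4 * l))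
  {η : (C.thetaEnvData μ hC hS).PiYdd → MuN p N} (hη : η ∈ (C.thetaEnvData μ hC hS).thetaCocycles)

/-- **At the stage-2 models, for EVERY étale-theta datum and EVERY choice `X̲̲`: «`Δ^tp_{X̲̲}` characteristic in `Π^tp_{X̲̲}`»
⟺ «`Δ^tp_{Y̲̲} = Δ ∩ Π^tp_{Y̲̲}` characteristic» — NO binder** (`Π^tp_{Y̲̲}` is characteristic there: abc-iut-w5-d233's
`isTopCharacteristic_GtpY_subgroupOf_Huu_modelχq` over abc-iut-w5-d091's compact `Π^tp_Y`). [cite: MochizukiEtTh2009, Prop 2.4 p.38] -/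
theorem isTopCharacteristic_deltaTemp_subgroupOf_Huu_modelχq_iff :
    IsTopCharacteristic C.Huu ((ThetaSetting.modelχq p i j hj).DeltaTemp.subgroupOf C.Huu) ↔
      IsTopCharacteristic C.Huu ((ThetaSetting.modelχq p i j hj).DeltaTemp.subgroupOf C.Huu ⊓
        (ThetaSetting.modelχq p i j hj).GtpY.subgroupOf C.Huu) :=
  C.isTopCharacteristic_deltaTemp_subgroupOf_iff (isTopCharacteristic_GtpY_subgroupOf_Huu_modelχq p i j hj C)

/-- **(H1) ⟺ MChar at the [IUTchII] §1 setting of the stage-2 models, NO binder** (every `E`, `X̲̲`, `μ`, `hζ`, `η`: the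
carrier's own data). [claim: Mochizuki2012, status: disputed] (IUTchII §1 Ex 1.8 (i), kurims p.35) -/
theorem deltaX_characteristic_ofDoubleUnderline_modelχq_iff_mChar :
    (∀ φ : (ThetaSetting.ofDoubleUnderline C μ hC hS hl hp2 hpl hζ hη).PiX ≃ₜ*
          (ThetaSetting.ofDoubleUnderline C μ hC hS hl hp2 hpl hζ hη).PiX,
        (ThetaSetting.ofDoubleUnderline C μ hC hS hl hp2 hpl hζ hη).DeltaX.map φ.toMulEquiv.toMonoidHom =
          (ThetaSetting.ofDoubleUnderline C μ hC hS hl hp2 hpl hζ hη).DeltaX) ↔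
      ∀ φ : (ThetaSetting.ofDoubleUnderline C μ hC hS hl hp2 hpl hζ hη).PiX ≃ₜ*
          (ThetaSetting.ofDoubleUnderline C μ hC hS hl hp2 hpl hζ hη).PiX,
        ((ThetaSetting.ofDoubleUnderline C μ hC hS hl hp2 hpl hζ hη).DeltaX ⊓
            (show Subgroup (ThetaSetting.ofDoubleUnderline C μ hC hS hl hp2 hpl hζ hη).PiX from
              (ThetaSetting.modelχq p i j hj).GtpY.subgroupOf C.Huu)).map φ.toMulEquiv.toMonoidHom =
          (ThetaSetting.ofDoubleUnderline C μ hC hS hl hp2 hpl hζ hη).DeltaX ⊓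
            (show Subgroup (ThetaSetting.ofDoubleUnderline C μ hC hS hl hp2 hpl hζ hη).PiX from
              (ThetaSetting.modelχq p i j hj).GtpY.subgroupOf C.Huu) :=
  ThetaSetting.deltaX_characteristic_ofDoubleUnderline_iff_of_piY C μ hC hS hl hp2 hpl hζ hη
    (isTopCharacteristic_GtpY_subgroupOf_Huu_modelχq p i j hj C)

end StageTwo

/-! ## §4. At the Tate model's carrier of record, in the literal `EtaleLevels.setting` currency of the binder `hΔX` -/

section Tate

variable (p : ℕ) [Fact p.Prime] (l : ℕ+) (hl : Odd (l : ℕ)) (hlp : (l : ℕ).Prime) (hdvd : 4 * (l : ℕ) ∣ p - 1)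
  {Es : Set ℕ+} (τ : (ThetaSetting.modelχq p 1 2 even_two).CyclotomeTower l Es)

/-- **(H1) `hΔX` ⟺ MChar at the `EtaleLevels` setting of the Tate model** (the carrier of record of `hq_setting_modelTate` /
`cor112_model_modelTate`: `inr`-section étale-theta datum carrying `η̈♯ = etaDdχq`, `Π^tp_{X̲̲} = Huuχq`, root cocycle
`rootLift C`, cyclotome tower `τ`): the custody binder `hΔX` of the [IUTchII] Cor. 1.12 model closer HOLDS IFF every topological
automorphism of `Π^tp_{X̲̲}` carries `Δ ∩ Π^tp_{Y̲̲}` onto itself (MChar) — NO other binder.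
[claim: Mochizuki2012, status: disputed] (IUTchII §1 Ex 1.8 (i), kurims p.35) -/
theorem hΔX_setting_modelTate_iff_mChar :
    let hC := compat_modelχq p 1 2 even_two
    let hS := ThetaSetting.modelχq_sec2Hyps p 1 2 even_two
    let K₀ := (kummerCoreχq p 1 2 even_two).toKummerDataOfSection SemidirectProduct.inr (continuous_inrχq p 1 2)
        (fun _ => rfl) (map_inr_GK_le_GtpY_modelχq' p 1 2 even_two) (map_inr_GKdd_le_GtpYdd_modelχq' p 1 2 even_two)
    let C := (K₀.etaleThetaDataOfClass (etaDdχq p 1 2 even_two)).doubleUnderlineχqOfEtaRes p 1 2 l hl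
        (eta_res_etaDdχq p 1 2 even_two l hl)
    let hp2 := ne_two_of_four_mul_dvd_pred p l.pos hdvd
    let hpl := ne_of_four_mul_dvd_pred p l.pos hdvd
    let hζ := exists_isPrimitiveRoot_K_modelχq p 1 2 even_two l.pos hdvd
    let S := EtaleLevels.setting C hC hS hlp hp2 hpl hζ τ.modAll (EtaleThetaDataOfSetting.rootLift C)
      (rootLift_mem_rootCocycles C hC)
    (∀ φ : S.PiX ≃ₜ* S.PiX, S.DeltaX.map φ.toMulEquiv.toMonoidHom = S.DeltaX) ↔
      ∀ φ : S.PiX ≃ₜ* S.PiX,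
        (S.DeltaX ⊓ (show Subgroup S.PiX from (ThetaSetting.modelχq p 1 2 even_two).GtpY.subgroupOf C.Huu)).map
            φ.toMulEquiv.toMonoidHom =
          S.DeltaX ⊓ (show Subgroup S.PiX from (ThetaSetting.modelχq p 1 2 even_two).GtpY.subgroupOf C.Huu) := by
  intro hC hS K₀ C hp2 hpl hζ S
  exact deltaX_characteristic_ofDoubleUnderline_modelχq_iff_mChar p 1 2 even_two C (τ.modAll 1) hC hS hlp hp2 hpl hζ
    (EtaleLevels.eta0_mem C hC hS τ.modAll _ (rootLift_mem_rootCocycles C hC) 1)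

/-- **The consumable direction: MChar ⇒ `hΔX`** at the `EtaleLevels` setting of the Tate model (plug into the `hΔX` binder of
`ModelTateCarriers.cor112_model_modelTate` / `…_inversion` / abc-iut-w4-d030's genuine monoids at `modelTate`).
[claim: Mochizuki2012, status: disputed] (IUTchII §1 Ex 1.8 (i), kurims p.35) -/
theorem hΔX_setting_modelTate_of_mChar :
    let hC := compat_modelχq p 1 2 even_two
    let hS := ThetaSetting.modelχq_sec2Hyps p 1 2 even_two
    let K₀ := (kummerCoreχq p 1 2 even_two).toKummerDataOfSection SemidirectProduct.inr (continuous_inrχq p 1 2)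
        (fun _ => rfl) (map_inr_GK_le_GtpY_modelχq' p 1 2 even_two) (map_inr_GKdd_le_GtpYdd_modelχq' p 1 2 even_two)
    let C := (K₀.etaleThetaDataOfClass (etaDdχq p 1 2 even_two)).doubleUnderlineχqOfEtaRes p 1 2 l hl
        (eta_res_etaDdχq p 1 2 even_two l hl)
    let hp2 := ne_two_of_four_mul_dvd_pred p l.pos hdvd
    let hpl := ne_of_four_mul_dvd_pred p l.pos hdvd
    let hζ := exists_isPrimitiveRoot_K_modelχq p 1 2 even_two l.pos hdvd
    let S := EtaleLevels.setting C hC hS hlp hp2 hpl hζ τ.modAll (EtaleThetaDataOfSetting.rootLift C)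
      (rootLift_mem_rootCocycles C hC)
    (∀ φ : S.PiX ≃ₜ* S.PiX,
        (S.DeltaX ⊓ (show Subgroup S.PiX from (ThetaSetting.modelχq p 1 2 even_two).GtpY.subgroupOf C.Huu)).map
            φ.toMulEquiv.toMonoidHom =
          S.DeltaX ⊓ (show Subgroup S.PiX from (ThetaSetting.modelχq p 1 2 even_two).GtpY.subgroupOf C.Huu)) →
      ∀ φ : S.PiX ≃ₜ* S.PiX, S.DeltaX.map φ.toMulEquiv.toMonoidHom = S.DeltaX := by
  intro hC hS K₀ C hp2 hpl hζ S hM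
  exact (hΔX_setting_modelTate_iff_mChar p l hl hlp hdvd τ).2 hM

end Tate

end ModelTateCarriers

end Literature.IUT.HodgeArakelov

end
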